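import Summits.HodgeConjecture.CorCM.MumfordTateRankRigidMonotone
import Summits.HodgeConjecture.CorCM.HodgeLieAlgebraReductive
import Literature.AlgebraicGeometry.Motives.HodgeLieRigidModuloCentre
import HarnessLib

/-!
# Rigidity modulo the centre for abelian varieties: every `Θ`-subalgebra of `Lie Hg(H¹X)` contains `[Lie Hg, Lie Hg]`;
# no factor of type IV ⟹ `H¹(X)` is `Θ`-rigid ⟹ `t(X₁ × X₂) ≥ t(X₁)` (Moonen–Zarhin (3.1) for all such `X₁`, unconditionally)

COR-CM (cell `pub-hodgecm2`, seat `b27` gen 54, count-neutral Mumford–Tate-rank ladder; theorems only, no definition, no named fact;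
UNCONDITIONAL — nothing here uses or asserts HC_CM).  `t(X) := dim MT(H¹X) = dim Lie Hg(H¹X) + 1`.  The ladder's monotonicity
`t(X₁ × X₂) ≥ t(X₁)` (`CorCM/MumfordTateRankRigidMonotone`) asks the factor `X₁` to be `Θ`-RIGID (every bracket-closed rational
`𝔞 ⊆ Lie Hg(H¹X₁)` with a Hodge operator in `𝔞 ⊗ ℂ` is everything), proved so far family by family (non-CM curves, QM and RM surfaces,
Ribet type `(g−1,1)`, simple CM surfaces, …).  `Motives/HodgeLieRigidModuloCentre` (gen 54) shows for EVERY polarizable Hodge structure that a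
`Θ`-subalgebra contains the derived algebra `[𝔥, 𝔥]` and `𝔥 = 𝔞 + 𝔷(𝔥)`; here the abelian-variety reading:
* §1 **`hodgeLie_hodge_one_derived_le_of_theta_mem`**, **`hodgeLie_hodge_one_le_sup_center_of_theta_mem`** — for EVERY complex abelian
  variety `X` and every `Θ`-subalgebra `𝔞 ⊆ Lie Hg(H¹X)`: `[Lie Hg, Lie Hg] ⊆ 𝔞` and `Lie Hg = 𝔞 + 𝔷`, `𝔷 = Lie Hg ∩ End_Hdg(H¹X)`
  (the `ψ`-skew central Hodge endomorphisms, `CorCM/HodgeLieAlgebraReductive`).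
* §2 **`hodgeLie_rigid_of_hasNoTypeIVFactor`** — NO SIMPLE FACTOR OF TYPE IV ⟹ `H¹(X)` is `Θ`-rigid (`𝔷 = 0`, Moonen–Zarhin §1 «`Hg` is
  semisimple», `hodgeLie_hodge_one_inf_endAlg_eq_bot_of_hasNoTypeIVFactor`); hence **`finrank_hodgeLie_hodge_one_le_prod_of_hasNoTypeIVFactor`**,
  **`mtRank_hodge_one_le_of_isIsogenous_prod_of_hasNoTypeIVFactor`**: `dim Lie Hg(H¹X₁) ≤ dim Lie Hg(H¹(X₁ × X₂))` and `t(X₁) ≤ t(X)` for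
  `X ∼ X₁ × X₂`, ANY `X₂`, whenever `X₁` has no factor of type IV (products of varieties of types I, II, III in any number and dimension).

## References
* [MoonenZarhin1999LowDim] B. Moonen, Yu. G. Zarhin, *Hodge classes on abelian varieties of low dimension*, Math. Ann. 315 (1999), §1, §3 (3.1)
  [corpus: paper:arxiv-math_9901113 pp. 2, 6]. [cite: MoonenZarhin1999LowDim, §3 (3.1)]
* [Deligne1982HodgeCycles] P. Deligne, LNM 900 (1982), I §3 Prop. 3.4, Prop. 3.6. [cite: Deligne1982HodgeCycles, I §3 Prop. 3.6]
* [GreenGriffithsKerr2012] M. Green, P. Griffiths, M. Kerr, *Mumford–Tate Groups and Domains* (2012), §I.B (I.B.5).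
  [cite: GreenGriffithsKerr2012, §I.B (I.B.3) and (I.B.5)]
-/

noncomputable section

open scoped TensorProduct
open CategoryTheory CategoryTheory.Limits Module

namespace Summit.HodgeConjecture.CorCM

open Literature.AlgebraicGeometry.Motives
open Literature.AlgebraicGeometry.Motives.AbelianVariety
open Literature.AlgebraicGeometry.Motives.HodgeStructure
open Literature.AlgebraicGeometry.HodgeTheory

variable [HodgeTensorFacts.{0, 0}] {X X₁ X₂ : AbelianVariety ℂ} {n n₁ : ℕ}

/-! ## §1 Every `Θ`-subalgebra of `Lie Hg(H¹X)` contains the derived algebra -/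

/-- **For EVERY complex abelian variety `X`: a bracket-closed rational `𝔞 ⊆ Lie Hg(H¹X)` whose complex span contains a Hodge operator
contains `[Lie Hg(H¹X), Lie Hg(H¹X)]`** (`Motives/HodgeLieRigidModuloCentre.derived_le_of_theta_mem` for the polarizable `H¹(X)`).
[cite: MoonenZarhin1999LowDim, §3 (3.1)] [cite: Deligne1982HodgeCycles, I §3 Prop. 3.6] -/
theorem hodgeLie_hodge_one_derived_le_of_theta_mem (hX : IsSmoothProjective n X.X) :
    haveI := BettiUniverse.finite hX 1
    ∀ 𝔞 : Submodule ℚ (Module.End ℚ (bettiCohomology X.X 1)),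
      𝔞 ≤ (BettiUniverse.hodge exists_isReal_hodgeModel_holds hX 1).hodgeLie →
      (∀ A ∈ 𝔞, ∀ B ∈ 𝔞, A * B - B * A ∈ 𝔞) →
      (∃ Θ ∈ Submodule.span ℂ ((fun A : Module.End ℚ (bettiCohomology X.X 1) => A.baseChange ℂ) ''
          (𝔞 : Set (Module.End ℚ (bettiCohomology X.X 1)))),
        ∀ p, ∀ x ∈ (BettiUniverse.hodge exists_isReal_hodgeModel_holds hX 1).piece p (((1 : ℕ) : ℤ) - p),
          Θ x = ((2 * p - ((1 : ℕ) : ℤ) : ℤ) : ℂ) • x) →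
      Submodule.span ℚ {B | ∃ A ∈ (BettiUniverse.hodge exists_isReal_hodgeModel_holds hX 1).hodgeLie,
          ∃ A' ∈ (BettiUniverse.hodge exists_isReal_hodgeModel_holds hX 1).hodgeLie, A * A' - A' * A = B} ≤ 𝔞 := by
  haveI := BettiUniverse.finite hX 1
  obtain ⟨ψ⟩ := BettiUniverse.hodge_isPolarizable exists_isReal_hodgeModel_holds hX 1
  intro 𝔞 h𝔞 hbr hΘ
  exact derived_le_of_theta_mem _ ψ 𝔞 h𝔞 hbr hΘ

/-- **… and `Lie Hg(H¹X) = 𝔞 + 𝔷`**, `𝔷 = Lie Hg(H¹X) ∩ End_Hdg(H¹X)` the centre: `Θ`-rigidity of an abelian variety can fail only in the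
centre of `Lie Hg`. [cite: MoonenZarhin1999LowDim, §3 (3.1)] [cite: Deligne1982HodgeCycles, I §3 Prop. 3.6] -/
theorem hodgeLie_hodge_one_le_sup_center_of_theta_mem (hX : IsSmoothProjective n X.X) :
    haveI := BettiUniverse.finite hX 1
    ∀ 𝔞 : Submodule ℚ (Module.End ℚ (bettiCohomology X.X 1)),
      𝔞 ≤ (BettiUniverse.hodge exists_isReal_hodgeModel_holds hX 1).hodgeLie →
      (∀ A ∈ 𝔞, ∀ B ∈ 𝔞, A * B - B * A ∈ 𝔞) →
      (∃ Θ ∈ Submodule.span ℂ ((fun A : Module.End ℚ (bettiCohomology X.X 1) => A.baseChange ℂ) ''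
          (𝔞 : Set (Module.End ℚ (bettiCohomology X.X 1)))),
        ∀ p, ∀ x ∈ (BettiUniverse.hodge exists_isReal_hodgeModel_holds hX 1).piece p (((1 : ℕ) : ℤ) - p),
          Θ x = ((2 * p - ((1 : ℕ) : ℤ) : ℤ) : ℂ) • x) →
      (BettiUniverse.hodge exists_isReal_hodgeModel_holds hX 1).hodgeLie ≤
        𝔞 ⊔ (BettiUniverse.hodge exists_isReal_hodgeModel_holds hX 1).hodgeLie ⊓
          Subalgebra.toSubmodule (BettiUniverse.hodge exists_isReal_hodgeModel_holds hX 1).endAlg := by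
  haveI := BettiUniverse.finite hX 1
  obtain ⟨ψ⟩ := BettiUniverse.hodge_isPolarizable exists_isReal_hodgeModel_holds hX 1
  intro 𝔞 h𝔞 hbr hΘ
  exact hodgeLie_le_sup_center_of_theta_mem _ ψ 𝔞 h𝔞 hbr hΘ

/-! ## §2 No factor of type IV ⟹ `Θ`-rigid ⟹ monotone -/

/-- **An abelian variety with no simple factor of type IV has `Θ`-rigid `H¹`**: every bracket-closed rational `𝔞 ⊆ Lie Hg(H¹X)` whose complex
span contains a Hodge operator is all of `Lie Hg(H¹X)` — `Lie Hg ∩ End_Hdg = 0` (Moonen–Zarhin §1, `hodgeLie_hodge_one_inf_endAlg_eq_bot_of_hasNoTypeIVFactor`)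
and rigidity holds modulo the centre (`rigid_of_center_eq_bot`). [cite: MoonenZarhin1999LowDim, §3 (3.1)] [cite: Deligne1982HodgeCycles, I §3 Prop. 3.6] -/
theorem hodgeLie_rigid_of_hasNoTypeIVFactor (hX : IsSmoothProjective n X.X) (hA4 : HasNoTypeIVFactor X) :
    haveI := BettiUniverse.finite hX 1
    ∀ 𝔞 : Submodule ℚ (Module.End ℚ (bettiCohomology X.X 1)),
      𝔞 ≤ (BettiUniverse.hodge exists_isReal_hodgeModel_holds hX 1).hodgeLie →
      (∀ A ∈ 𝔞, ∀ B ∈ 𝔞, A * B - B * A ∈ 𝔞) →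
      (∃ Θ ∈ Submodule.span ℂ ((fun A : Module.End ℚ (bettiCohomology X.X 1) => A.baseChange ℂ) ''
          (𝔞 : Set (Module.End ℚ (bettiCohomology X.X 1)))),
        ∀ p, ∀ x ∈ (BettiUniverse.hodge exists_isReal_hodgeModel_holds hX 1).piece p (((1 : ℕ) : ℤ) - p),
          Θ x = ((2 * p - ((1 : ℕ) : ℤ) : ℤ) : ℂ) • x) →
      (BettiUniverse.hodge exists_isReal_hodgeModel_holds hX 1).hodgeLie ≤ 𝔞 := by
  haveI := BettiUniverse.finite hX 1
  exact rigid_of_center_eq_bot _ (BettiUniverse.hodge_isPolarizable exists_isReal_hodgeModel_holds hX 1)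
    (hodgeLie_hodge_one_inf_endAlg_eq_bot_of_hasNoTypeIVFactor hX hA4)

/-- **`dim Lie Hg(H¹X₁) ≤ dim Lie Hg(H¹(X₁ × X₂))` whenever `X₁` has no simple factor of type IV** (any `X₂`): Moonen–Zarhin's
«`Hg(X₁ × X₂) → Hg(X₁)` is surjective» in dimension form, for all such `X₁` at once. [cite: MoonenZarhin1999LowDim, §3 (3.1)] -/
theorem finrank_hodgeLie_hodge_one_le_prod_of_hasNoTypeIVFactor (hX₁ : IsSmoothProjective n₁ X₁.X) {m : ℕ}
    (hP : IsSmoothProjective m (X₁.prod X₂).X) (hA4 : HasNoTypeIVFactor X₁) :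
    haveI := BettiUniverse.finite hP 1
    haveI := BettiUniverse.finite hX₁ 1
    Module.finrank ℚ (BettiUniverse.hodge exists_isReal_hodgeModel_holds hX₁ 1).hodgeLie ≤
      Module.finrank ℚ (BettiUniverse.hodge exists_isReal_hodgeModel_holds hP 1).hodgeLie :=
  finrank_hodgeLie_hodge_one_le_prod_of_rigid hX₁ hP (hodgeLie_rigid_of_hasNoTypeIVFactor hX₁ hA4)

/-- **`t(X₁) ≤ t(X)` for `X ∼ X₁ × X₂` whenever `X₁` has no simple factor of type IV** (`t = dim MT(H¹·)`; any `X₂`).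
[cite: MoonenZarhin1999LowDim, §3 (3.1)] -/
theorem mtRank_hodge_one_le_of_isIsogenous_prod_of_hasNoTypeIVFactor (hX : IsSmoothProjective n X.X) (hX₁ : IsSmoothProjective n₁ X₁.X)
    (h₁ : 0 < X₁.dim) (hA4 : HasNoTypeIVFactor X₁) (hXP : IsIsogenous X (X₁.prod X₂)) :
    haveI := BettiUniverse.finite hX 1
    haveI := BettiUniverse.finite hX₁ 1
    (BettiUniverse.hodge exists_isReal_hodgeModel_holds hX₁ 1).mtRank ≤ (BettiUniverse.hodge exists_isReal_hodgeModel_holds hX 1).mtRank :=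
  mtRank_hodge_one_le_of_isIsogenous_prod_of_rigid hX hX₁ h₁ (hodgeLie_rigid_of_hasNoTypeIVFactor hX₁ hA4) hXP

end Summit.HodgeConjecture.CorCM

end
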